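import Summits.QuantumFields.BalabanUV.Beta.D1BFx.NeedleRowGlue
import Summits.QuantumFields.BalabanUV.Beta.D1BFx.NeedleRowsAtRay
import Summits.QuantumFields.BalabanUV.Beta.D1BFx.GluonNeedleRowT3

/-!
# `BalabanUV.Beta.D1BFx.NeedleGroupRow` — road «BF-x» for binder row D1, slot (K), END row `hGrp gN`, «GN-ROW»: THE NEEDLE-GROUP ROW OF THE END OF RECORD
# (`NeedleRowGlue.abs_gN_row_le_of_tables`, fibre `needleFibre'`, 44 words) IS n-UNIFORMLY BOUNDED AT THE RAY OF RECORD, modulo [B5, Prop. 1.2] ∧ [B5, (1.126)–(1.127)]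
# BY NAME, the END's pins (`hlam`, `cE = n⁴`, `cR = −cE`, `hω`), the ray (`cK n = cgh n·n²`, `cQ n = cgh n·a`, `x₀ n = −cgh n`, DISPLAYED `|cgh n| ≤ cgh₀` — P13) and
# FIVE displayed inputs not yet in the tree: the gluon cells T₂-K (leaf-03-g13), NK∕KN (leaf-01), KK's pairing letter `h𝔅₂₂` (leaf-04-g10) and the slot-4
# tadpole row T₈ (`h₈`; OPEN: the two-bond table `WQ` awaits its (A2) pin) — seven of the eight table rows are WIRED FROM TREE THEOREMS

HONEST DEPENDENCY (cell records, verbatim): «continuum YM on T⁴ ⇐ BetaPertH ∧ nine spine estimates (0/9 proved); BetaPertH ⇐ (D1) ∧ (D4) ∧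
CAP+tail; G-an2-4 gates asym, D1 and NE2/3/4.»  HONEST FRAMING (cell contract, verbatim): «discharging `BetaPertH` makes Bałaban's UV stability
UNCONDITIONAL — a real constructive-QFT result; it is NOT the continuum limit and NOT the Clay problem.»  THIS MODULE DISCHARGES NOTHING of the
wall: [folklore] wiring BY NAME — `NeedleRowGlue.abs_gN_row_le_of_tables` (owner gen 9) fed with `GluonNeedleRowsT12.h₁_of_prop12 ∕ h₂_of_prop12`,
`GluonNeedleRowT3.h₃_of_prop12` (owner gen 11; the gluon rows T₁ T₂ T₃ from the swarm's fifteen cells — PP∕T₁-P∕T₂-P owner, NP∕PN∕T₁-Q̇∕T₂-Q̇ leaf-01, NN gan24-leaf-05-g42,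
KK leaf-04-g9, PK∕KP leaf-04-g10, T₁-K leaf-03-g13), `NeedleRowsAtRay.h₄_of_ray ∕ h₅_of_ray ∕ h₆_of_ray ∕ h₇_of_ray` (owner gen 9 over leaf-04-g8's and gan24-leaf-05-g41's
closers; M10 inside).  No `def`, no `def … : Prop`, nothing cited, 0 sorry; EVERY remaining input is a displayed HYPOTHESIS (list above).  Root-level binders hW ∕
hR-sockets ∕ hSX-socket ∕ D1Tel ∕ D1Rep — 0 discharged; (K) NOT closed; NOT D1, NOT `BetaPertH`, NOT continuum, NOT Clay.

ABSOLUTE RULE (cell charter, verbatim): «No internally-minted statement may enter as a cited fact. Every hypothesis is either kernel-proved in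
this package or a verbatim quotation of a PUBLISHED theorem with page reference. The manuscript(s) under audit are NOT citable for their own
disputed steps — they are the thing under adjudication; programme-internal (2001/route/tribunal) claims are never citable.»

CONTENT.
* §3 (v1.2) [folklore] **`abs_gN_row_le_of_prop12''`** — the same modulo `h₈` (T₈) ONLY (NK∕KN discharged: leaf-01 p281106∕p282148).
* §2 (v1.1) [folklore] **`abs_gN_row_le_of_prop12'`** — the same modulo `hNK`, `hKN`, `h₈` ONLY (T₂-K and `h𝔅₂₂` discharged: p275613, p275771).
* §1 [folklore] **`abs_gN_row_le_of_prop12`** — `∃ C, ∀ n ≥ 2, |Σ_{b ∈ image resSite} n⁻⁴·fullSum (w ↦ Σ_{τ : grp τ = gN} restK′ … τ w)| ≤ C` from the fibre datum `hfib`,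
  the printed statements, the pins, the ray, the slot-4 socket `hQW`, and the five displayed inputs (`hT₂K`, `hNK`, `hKN` in the auxiliary-weight form; `h𝔅₂₂`; `h₈`).
NOT HERE (honest): those five; the LOCAL and Λ rows; `RoadEndBFxRows.hGrp_of_rows`.
Unit `b2b-balaban-beta-d1-p2` (gen 11), road «BF-x» OWNER; `LEAVES-BFx.md` row (N) «GN-ROW».
-/

noncomputable section

open Finset Filter Topology
open scoped BigOperators
open Literature.MathematicalPhysics.QuantumFieldTheory.Balaban1983to89
open Literature.MathematicalPhysics.QuantumFieldTheory.Balaban1983to89.Beta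
open WindowIdentification (fullSum)
open DyadicShell (Pt toReal)
open ExpKernelCalculus (Site MKer BiLoc)
open DressedMomentNormalisation (resSite)
open AffineAveraging (unitVec)
open VectorTailsLoc (fam kfam)
open PoissonInterior (nrm supNorm)
open Summit.QuantumFields.BalabanUV.Beta.TameKernelCalculus (Spr)
open Summit.QuantumFields.BalabanUV.Beta.D1BFx.GluonLeg (Ga)
open Summit.QuantumFields.BalabanUV.Beta.D1BFx.GluonLegTails (spr_Ga_of_prop12)
open Summit.QuantumFields.BalabanUV.Beta.D1BFx.FrozenLegTails (nOf MOf hn1)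
open Summit.QuantumFields.BalabanUV.Beta.D1BFx.GhostLeg (Ggh)
open Summit.QuantumFields.BalabanUV.Beta.D1BFx.RProjector (Pgt)
open Summit.QuantumFields.BalabanUV.Beta.D1BFx.RProjectorJet (RG)
open Summit.QuantumFields.BalabanUV.Beta.D1BFx.ReducedKernel (TableR)
open Summit.QuantumFields.BalabanUV.Beta.D1BFx.DressedTadpoleTable (tadpoleTable)
open Summit.QuantumFields.BalabanUV.Beta.D1BFx.SectorRecut (SbT)
open Summit.QuantumFields.BalabanUV.Beta.D1BFx.GluonNeedleSplit (dipPiece ndlPiece)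
open Summit.QuantumFields.BalabanUV.Beta.D1BFx.GluonNeedleGlue (cellSum)
open Summit.QuantumFields.BalabanUV.Beta.D1BFx.FrozenLegProfile (gfrz)
open Summit.QuantumFields.BalabanUV.Beta.D1BFx.SplitInstance (RestIdx)
open Summit.QuantumFields.BalabanUV.Beta.D1BFx.SplitRecut (restK')
open Summit.QuantumFields.BalabanUV.Beta.D1BFx.RankOneBubble (applyK pairing)
open Summit.QuantumFields.BalabanUV.Beta.D1BFx.RankOneBubbleJets (grad)
open Summit.QuantumFields.BalabanUV.Beta.D1BFx.NeedleGroupPointwise (needleFibre')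
open Summit.QuantumFields.BalabanUV.Beta.D1BFx.NeedleRowGlue (abs_gN_row_le_of_tables)
open Summit.QuantumFields.BalabanUV.Beta.D1BFx.NeedleRowsAtRay (h₄_of_ray h₅_of_ray h₆_of_ray h₇_of_ray)
open Summit.QuantumFields.BalabanUV.Beta.D1BFx.GluonNeedleRowsT12 (h₁_of_prop12 h₂_of_prop12)
open Summit.QuantumFields.BalabanUV.Beta.D1BFx.GluonNeedleRowT3 (h₃_of_prop12)

namespace Summit.QuantumFields.BalabanUV.Beta.D1BFx.NeedleGroupRow

variable {a N cgh₀ : ℝ} {μ ν : Fin 4} {cE cΛ cR cK cQ cE₂ cJ4 cΛ₂ cR₂ cQ₂ x₀ ωgl ωgh cgh : ℕ → ℝ} {WE WJ WΛ WR WQ : ℕ → TableR}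
  {CQ δW : ℕ → ℝ} {G : Type*} [DecidableEq G] {grp : RestIdx → G} {gN : G}

/-- [folklore] **«GN-ROW»: THE NEEDLE-GROUP ROW OF THE END OF RECORD IS n-UNIFORMLY BOUNDED AT THE RAY OF RECORD**, modulo [B5, Prop. 1.2] ∧ [B5, (1.126)–(1.127)]
BY NAME, the END's pins `hlam`∕`hcE`∕`hR`∕`hω`, the ray `hK`∕`hQ`∕`hx` with the displayed scalar letter `hcgh : |cgh n| ≤ cgh₀` (P13), the fibre datum `hfib`, the slot-4
socket `hQW`, and FIVE displayed inputs: `hT₂K` (T₂'s `dip ⊗ SbT` piece), `hNK`∕`hKN` (T₃'s `ndl ⊗ dip` ∕ `dip ⊗ ndl` cells) — all in the auxiliary-weight form —,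
KK's pairing letter `h𝔅₂₂`, and the slot-4 tadpole row `h₈` (T₈).  Seven of the eight table rows of `NeedleRowGlue.abs_gN_row_le_of_tables` are tree theorems here. -/
theorem abs_gN_row_le_of_prop12 (hfib : ∀ τ : RestIdx, grp τ = gN ↔ τ ∈ needleFibre') (ha : 0 < a)
    (h12 : B5.Prop12Printed (fam nOf hn1 MOf a ha)) (h126 : B5.Kernel126_127Printed (kfam nOf MOf))
    (hlam : ∀ n : ℕ, 2 ≤ n → ωgl n * cE n ^ 2 = 2 * N ^ 2 * (n : ℝ) ^ 8) (hcE : ∀ n : ℕ, 2 ≤ n → cE n = (n : ℝ) ^ 4)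
    (hR : ∀ n : ℕ, 2 ≤ n → cR n = -cE n) (hω : ∀ n : ℕ, 2 ≤ n → ωgh n * cK n ^ 2 = -2 * (ωgl n * cE n ^ 2))
    (hcgh : ∀ n : ℕ, |cgh n| ≤ cgh₀) (hK : ∀ n : ℕ, cK n = cgh n * (n : ℝ) ^ 2) (hQ : ∀ n : ℕ, cQ n = cgh n * a) (hx : ∀ n : ℕ, x₀ n = -cgh n)
    (hδW : ∀ n, 0 < δW n) (hQW : ∀ n κ u l u', BiLoc (WQ n κ u l u') u u' (CQ n) (δW n))
    (hT₂K : ∃ C : ℝ, 0 ≤ C ∧ ∀ (n : ℕ) [NeZero n], |cgh₀ * (n : ℝ) ^ 2 * cellSum n a (dipPiece n a) SbT μ ν| ≤ C)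
    (hNK : ∃ C : ℝ, 0 ≤ C ∧ ∀ (n : ℕ) [NeZero n], |cgh₀ * (n : ℝ) ^ 2 * cellSum n a (ndlPiece n a (cQ n)) (dipPiece n a) μ ν| ≤ C)
    (hKN : ∃ C : ℝ, 0 ≤ C ∧ ∀ (n : ℕ) [NeZero n], |cgh₀ * (n : ℝ) ^ 2 * cellSum n a (dipPiece n a) (ndlPiece n a (cQ n)) μ ν| ≤ C)
    {K𝔅 : ℝ} (hK𝔅 : 0 ≤ K𝔅)
    (h𝔅₂₂ : ∀ (n : ℕ) [NeZero n] (u v : Site 4) (κ κ' : Fin 4),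
      |pairing (grad (fun x => RG (Ggh n a) (Pgt n a) x (u + unitVec κ) () () - RG (Ggh n a) (Pgt n a) x u () ()))
        (applyK (Ga n a) (grad (fun x => RG (Ggh n a) (Pgt n a) x (v + unitVec κ') () () - RG (Ggh n a) (Pgt n a) x v () ())))|
        ≤ K𝔅 / (n : ℝ) ^ 4 / nrm (u - v) ^ 2 + K𝔅 / (n : ℝ) ^ 6)
    {C₈ : ℝ}
    (h₈ : ∀ n : ℕ, 2 ≤ n → ∀ [NeZero n], |ωgl n * cQ₂ n * ∑ b ∈ (univ : Finset (Fin 4 → Fin n)).image resSite, ((n : ℝ) ^ 4)⁻¹ * (((n : ℝ) ^ 8)⁻¹ *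
      fullSum (fun w : Pt => toReal w μ * toReal w ν * tadpoleTable n a (WQ n) μ ν (b + w) b))| ≤ C₈) :
    ∃ C : ℝ, ∀ n : ℕ, 2 ≤ n → ∀ [NeZero n],
      |∑ b ∈ (univ : Finset (Fin 4 → Fin n)).image resSite, ((n : ℝ) ^ 4)⁻¹ *
        fullSum (fun w : Pt => ∑ τ ∈ (univ : Finset RestIdx).filter (fun τ => grp τ = gN),
          restK' n a (gfrz n a b) (cE n) (cΛ n) (cR n) (cK n) (cQ n) (cE₂ n) (cJ4 n) (cΛ₂ n) (cR₂ n) (cQ₂ n) (x₀ n)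
            (WE n) (WJ n) (WΛ n) (WR n) (WQ n) (ωgl n) (ωgh n) ((n : ℝ) ^ 8) N μ ν b τ w)| ≤ C := by
  have hGa : ∀ n : ℕ, 2 ≤ n → ∀ [NeZero n], Spr (Ga n a) := fun n _ _ => spr_Ga_of_prop12 (a := a) (ha := ha) h12 h126 n
  obtain ⟨C₁, _, h₁⟩ := h₁_of_prop12 (N := N) (cE := cE) (cR := cR) (cK := cK) (cQ := cQ) (ωgl := ωgl) ha h12 h126 hlam hcE hR hcgh hK hQ μ ν
  obtain ⟨C₂, _, h₂⟩ := h₂_of_prop12 (N := N) (cE := cE) (cR := cR) (cK := cK) (cQ := cQ) (ωgl := ωgl) ha h12 h126 hlam hcE hR hcgh hK hQ μ ν hT₂K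
  obtain ⟨C₃, _, h₃⟩ := h₃_of_prop12 (N := N) (cE := cE) (cR := cR) (cK := cK) (cQ := cQ) (ωgl := ωgl) ha h12 h126 hlam hcE hR hcgh hK hQ μ ν hNK hKN hK𝔅 h𝔅₂₂
  have h₄ := h₄_of_ray (ωgh := ωgh) ha hω hlam hK hQ μ ν
  have h₅ := h₅_of_ray (ωgh := ωgh) ha hω hlam hK hQ μ ν
  have h₆ := h₆_of_ray (ωgh := ωgh) ha hω hlam hK hQ μ ν
  have h₇ := h₇_of_ray (ωgh := ωgh) ha hω hlam hK hQ hx μ ν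
  exact ⟨_, abs_gN_row_le_of_tables hfib ha hGa hδW hQW h₁ h₂ h₃ h₄ h₅ h₆ h₇ h₈⟩

/-! ## §2 (v1.1, APPENDED 2026-08-21 after «T₂-K» `GluonDipLocalRow` p275613 (leaf-03-g13) and «h𝔅₂₂» `NeedleDipWardLetter` p275771 (leaf-04-g10) landed) -/

open Summit.QuantumFields.BalabanUV.Beta.D1BFx.GluonNeedleRowsT12 (h₂_of_prop12') in
open Summit.QuantumFields.BalabanUV.Beta.D1BFx.GluonNeedleRowT3 (h₃_of_prop12') in
/-- [folklore] **«GN-ROW» v1.1: THE NEEDLE-GROUP ROW OF THE END AT THE RAY OF RECORD MODULO THREE DISPLAYED INPUTS ONLY** — the cells NK∕KN (`hNK`, `hKN`,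
auxiliary-weight form; leaf-01) and the slot-4 tadpole row T₈ (`h₈`; `WQ` awaits its (A2) pin); T₂-K and `h𝔅₂₂` are now tree theorems (`GluonNeedleRowsT12.h₂_of_prop12'`,
`GluonNeedleRowT3.h₃_of_prop12'`).  Displayed as before: `hfib`, h12∕h126, `hlam`∕`hcE`∕`hR`∕`hω`, the ray `hK`∕`hQ`∕`hx` with `hcgh` (P13), the slot-4 socket `hQW`∕`hδW`. -/
theorem abs_gN_row_le_of_prop12' (hfib : ∀ τ : RestIdx, grp τ = gN ↔ τ ∈ needleFibre') (ha : 0 < a)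
    (h12 : B5.Prop12Printed (fam nOf hn1 MOf a ha)) (h126 : B5.Kernel126_127Printed (kfam nOf MOf))
    (hlam : ∀ n : ℕ, 2 ≤ n → ωgl n * cE n ^ 2 = 2 * N ^ 2 * (n : ℝ) ^ 8) (hcE : ∀ n : ℕ, 2 ≤ n → cE n = (n : ℝ) ^ 4)
    (hR : ∀ n : ℕ, 2 ≤ n → cR n = -cE n) (hω : ∀ n : ℕ, 2 ≤ n → ωgh n * cK n ^ 2 = -2 * (ωgl n * cE n ^ 2))
    (hcgh : ∀ n : ℕ, |cgh n| ≤ cgh₀) (hK : ∀ n : ℕ, cK n = cgh n * (n : ℝ) ^ 2) (hQ : ∀ n : ℕ, cQ n = cgh n * a) (hx : ∀ n : ℕ, x₀ n = -cgh n)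
    (hδW : ∀ n, 0 < δW n) (hQW : ∀ n κ u l u', BiLoc (WQ n κ u l u') u u' (CQ n) (δW n))
    (hNK : ∃ C : ℝ, 0 ≤ C ∧ ∀ (n : ℕ) [NeZero n], |cgh₀ * (n : ℝ) ^ 2 * cellSum n a (ndlPiece n a (cQ n)) (dipPiece n a) μ ν| ≤ C)
    (hKN : ∃ C : ℝ, 0 ≤ C ∧ ∀ (n : ℕ) [NeZero n], |cgh₀ * (n : ℝ) ^ 2 * cellSum n a (dipPiece n a) (ndlPiece n a (cQ n)) μ ν| ≤ C)
    {C₈ : ℝ}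
    (h₈ : ∀ n : ℕ, 2 ≤ n → ∀ [NeZero n], |ωgl n * cQ₂ n * ∑ b ∈ (univ : Finset (Fin 4 → Fin n)).image resSite, ((n : ℝ) ^ 4)⁻¹ * (((n : ℝ) ^ 8)⁻¹ *
      fullSum (fun w : Pt => toReal w μ * toReal w ν * tadpoleTable n a (WQ n) μ ν (b + w) b))| ≤ C₈) :
    ∃ C : ℝ, ∀ n : ℕ, 2 ≤ n → ∀ [NeZero n],
      |∑ b ∈ (univ : Finset (Fin 4 → Fin n)).image resSite, ((n : ℝ) ^ 4)⁻¹ *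
        fullSum (fun w : Pt => ∑ τ ∈ (univ : Finset RestIdx).filter (fun τ => grp τ = gN),
          restK' n a (gfrz n a b) (cE n) (cΛ n) (cR n) (cK n) (cQ n) (cE₂ n) (cJ4 n) (cΛ₂ n) (cR₂ n) (cQ₂ n) (x₀ n)
            (WE n) (WJ n) (WΛ n) (WR n) (WQ n) (ωgl n) (ωgh n) ((n : ℝ) ^ 8) N μ ν b τ w)| ≤ C := by
  have hGa : ∀ n : ℕ, 2 ≤ n → ∀ [NeZero n], Spr (Ga n a) := fun n _ _ => spr_Ga_of_prop12 (a := a) (ha := ha) h12 h126 n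
  obtain ⟨C₁, _, h₁⟩ := h₁_of_prop12 (N := N) (cE := cE) (cR := cR) (cK := cK) (cQ := cQ) (ωgl := ωgl) ha h12 h126 hlam hcE hR hcgh hK hQ μ ν
  obtain ⟨C₂, _, h₂⟩ := h₂_of_prop12' (N := N) (cE := cE) (cR := cR) (cK := cK) (cQ := cQ) (ωgl := ωgl) ha h12 h126 hlam hcE hR hcgh hK hQ μ ν
  obtain ⟨C₃, _, h₃⟩ := h₃_of_prop12' (N := N) (cE := cE) (cR := cR) (cK := cK) (cQ := cQ) (ωgl := ωgl) ha h12 h126 hlam hcE hR hcgh hK hQ μ ν hNK hKN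
  have h₄ := h₄_of_ray (ωgh := ωgh) ha hω hlam hK hQ μ ν
  have h₅ := h₅_of_ray (ωgh := ωgh) ha hω hlam hK hQ μ ν
  have h₆ := h₆_of_ray (ωgh := ωgh) ha hω hlam hK hQ μ ν
  have h₇ := h₇_of_ray (ωgh := ωgh) ha hω hlam hK hQ hx μ ν
  exact ⟨_, abs_gN_row_le_of_tables hfib ha hGa hδW hQW h₁ h₂ h₃ h₄ h₅ h₆ h₇ h₈⟩

/-! ## §3 (v1.2, APPENDED 2026-08-21 after leaf-01's NK∕KN landed: `GluonNeedleRowT3.h₃_of_prop12''`) The needle-group row modulo T₈ ONLY -/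

open Summit.QuantumFields.BalabanUV.Beta.D1BFx.GluonNeedleRowsT12 (h₂_of_prop12') in
open Summit.QuantumFields.BalabanUV.Beta.D1BFx.GluonNeedleRowT3 (h₃_of_prop12'') in
/-- [folklore] **«GN-ROW» v1.2: THE NEEDLE-GROUP ROW OF THE END AT THE RAY OF RECORD MODULO THE SLOT-4 TADPOLE ROW T₈ ONLY** (`h₈`; `WQ` awaits its (A2) pin):
the seven other table rows are tree theorems (gluon T₁ T₂ T₃ with no cell hypothesis; ghost T₄–T₇ at the ray — the latter UNDER READING (i) of `hω`, owner ruling ρ-g11-4∕8,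
Q-GU-1′ open).  Displayed as before: `hfib`, h12∕h126, `hlam`∕`hcE`∕`hR`∕`hω`, the ray `hK`∕`hQ`∕`hx` with `hcgh` (P13), the slot-4 socket `hQW`∕`hδW`. -/
theorem abs_gN_row_le_of_prop12'' (hfib : ∀ τ : RestIdx, grp τ = gN ↔ τ ∈ needleFibre') (ha : 0 < a)
    (h12 : B5.Prop12Printed (fam nOf hn1 MOf a ha)) (h126 : B5.Kernel126_127Printed (kfam nOf MOf))
    (hlam : ∀ n : ℕ, 2 ≤ n → ωgl n * cE n ^ 2 = 2 * N ^ 2 * (n : ℝ) ^ 8) (hcE : ∀ n : ℕ, 2 ≤ n → cE n = (n : ℝ) ^ 4)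
    (hR : ∀ n : ℕ, 2 ≤ n → cR n = -cE n) (hω : ∀ n : ℕ, 2 ≤ n → ωgh n * cK n ^ 2 = -2 * (ωgl n * cE n ^ 2))
    (hcgh : ∀ n : ℕ, |cgh n| ≤ cgh₀) (hK : ∀ n : ℕ, cK n = cgh n * (n : ℝ) ^ 2) (hQ : ∀ n : ℕ, cQ n = cgh n * a) (hx : ∀ n : ℕ, x₀ n = -cgh n)
    (hδW : ∀ n, 0 < δW n) (hQW : ∀ n κ u l u', BiLoc (WQ n κ u l u') u u' (CQ n) (δW n))
    {C₈ : ℝ}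
    (h₈ : ∀ n : ℕ, 2 ≤ n → ∀ [NeZero n], |ωgl n * cQ₂ n * ∑ b ∈ (univ : Finset (Fin 4 → Fin n)).image resSite, ((n : ℝ) ^ 4)⁻¹ * (((n : ℝ) ^ 8)⁻¹ *
      fullSum (fun w : Pt => toReal w μ * toReal w ν * tadpoleTable n a (WQ n) μ ν (b + w) b))| ≤ C₈) :
    ∃ C : ℝ, ∀ n : ℕ, 2 ≤ n → ∀ [NeZero n],
      |∑ b ∈ (univ : Finset (Fin 4 → Fin n)).image resSite, ((n : ℝ) ^ 4)⁻¹ *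
        fullSum (fun w : Pt => ∑ τ ∈ (univ : Finset RestIdx).filter (fun τ => grp τ = gN),
          restK' n a (gfrz n a b) (cE n) (cΛ n) (cR n) (cK n) (cQ n) (cE₂ n) (cJ4 n) (cΛ₂ n) (cR₂ n) (cQ₂ n) (x₀ n)
            (WE n) (WJ n) (WΛ n) (WR n) (WQ n) (ωgl n) (ωgh n) ((n : ℝ) ^ 8) N μ ν b τ w)| ≤ C := by
  have hGa : ∀ n : ℕ, 2 ≤ n → ∀ [NeZero n], Spr (Ga n a) := fun n _ _ => spr_Ga_of_prop12 (a := a) (ha := ha) h12 h126 n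
  obtain ⟨C₁, _, h₁⟩ := h₁_of_prop12 (N := N) (cE := cE) (cR := cR) (cK := cK) (cQ := cQ) (ωgl := ωgl) ha h12 h126 hlam hcE hR hcgh hK hQ μ ν
  obtain ⟨C₂, _, h₂⟩ := h₂_of_prop12' (N := N) (cE := cE) (cR := cR) (cK := cK) (cQ := cQ) (ωgl := ωgl) ha h12 h126 hlam hcE hR hcgh hK hQ μ ν
  obtain ⟨C₃, _, h₃⟩ := h₃_of_prop12'' (N := N) (cE := cE) (cR := cR) (cK := cK) (cQ := cQ) (ωgl := ωgl) ha h12 h126 hlam hcE hR hcgh hK hQ μ ν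
  have h₄ := h₄_of_ray (ωgh := ωgh) ha hω hlam hK hQ μ ν
  have h₅ := h₅_of_ray (ωgh := ωgh) ha hω hlam hK hQ μ ν
  have h₆ := h₆_of_ray (ωgh := ωgh) ha hω hlam hK hQ μ ν
  have h₇ := h₇_of_ray (ωgh := ωgh) ha hω hlam hK hQ hx μ ν
  exact ⟨_, abs_gN_row_le_of_tables hfib ha hGa hδW hQW h₁ h₂ h₃ h₄ h₅ h₆ h₇ h₈⟩

end Summit.QuantumFields.BalabanUV.Beta.D1BFx.NeedleGroupRow

end
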